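import Literature.Probability.LatticeModels.OnsagerSzego
import Literature.Probability.LatticeModels.OnsagerToeplitzDecay
import HarnessLib

/-!
# The long-range order of the plus state along a row: `twoPointPlus_row_tendsto_onsagerYang_sq` discharged

Topic `Probability/LatticeModels`, namespace `Literature.Probability.LatticeModels`. Sibling proof
file of `OnsagerYang.lean`, which introduced the named fact
`Literature.Probability.LatticeModels.twoPointPlus_row_tendsto_onsagerYang_sq`:

> for the nearest-neighbour Ising model on `ℤ²` and `β > β_c(2) = ½ log(1+√2)`, the plus-state
> two-point function along the first axis, `⟨σ_0 σ_{(n,0)}⟩⁺_{β,0}`, converges as `n → ∞` to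
> `m_O(β)² = (1 − sinh(2β)^{-4})^{1/4}`

(G. Benettin, G. Gallavotti, G. Jona-Lasinio, A. L. Stella, *On the Onsager–Yang value of the
spontaneous magnetization*, Comm. Math. Phys. **30** (1973) 45–54, §3: eq. (3.1)
"`⟨σ_xσ_y⟩_a = ⟨σ_xσ_y⟩_p = ⟨σ_xσ_y⟩_+`" for `x, y` on one row and `β > β_c`, from the GKS sandwich
(3.6)–(3.7) and the duality identity (3.10); with eq. (3.4) "`m_O²(β) = lim_{|x−y|→∞} ⟨σ_xσ_y⟩_p`",
the exact solution — E. W. Montroll, R. B. Potts, J. C. Ward, J. Math. Phys. **4** (1963) 308;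
T. D. Schultz, D. C. Mattis, E. H. Lieb, Rev. Mod. Phys. **36** (1964) 856).

`OnsagerYang.lean` cannot host the discharge (every file of the chain below imports it), hence this
sibling. The proof is the assembly `OnsagerSzego.twoPointPlus_row_tendsto_onsagerYang_sq_of_toeplitzDet_wu`
(BGJS's own argument: sandwich (3.7) `torusRowPairLimit_sandwich_at`, duality (3.10) through
`m*(β*) = 0` at the dual `β* < β_c(2)`, and (3.4) through the strong Szegő limit theorem for
geometric symbols, `Literature.Analysis.Toeplitz.strongSzego_geometric`) fed with the two
exact-solution inputs, both THEOREMS of the tree: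

* `OnsagerToeplitzProofs.torusRowPair_tendsto_toeplitzDet_holds` — the cylinder row correlations
  converge to the Toeplitz determinant `D_k(φ_β)` of Onsager's symbol (Montroll–Potts–Ward 1963 /
  Schultz–Mattis–Lieb 1964; Deift–Its–Krasovsky 2013, §4, eq. (50));
* `OnsagerToeplitzDecay.toeplitzDet_onsagerSymbol_exp_decay_holds` — Wu's decay
  `|D_k(φ_β)| ≤ C e^{-ck}` for `0 < β < β_c(2)` (T. T. Wu, Phys. Rev. **149** (1966) 380;
  Deift–Its–Krasovsky 2013, §5, eq. (64)), used only for `m*(β*) = 0` in the duality step.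

No definitions, no new named facts; one discharge.

## References

* G. Benettin, G. Gallavotti, G. Jona-Lasinio, A. L. Stella, Comm. Math. Phys. 30 (1973) 45–54, §3.
* E. W. Montroll, R. B. Potts, J. C. Ward, J. Math. Phys. 4 (1963) 308–322.
* T. T. Wu, Phys. Rev. 149 (1966) 380–401.
* P. Deift, A. Its, I. Krasovsky, Comm. Pure Appl. Math. 66 (2013) 1360–1438, §§4–5.
-/

noncomputable section

namespace Literature.Probability.LatticeModels

/-- **BGJS 1973, eq. (3.1) with eq. (3.4), proved** (the named fact
`twoPointPlus_row_tendsto_onsagerYang_sq` of `OnsagerYang.lean`): for the nearest-neighbour Ising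
model on `ℤ²` and `β > β_c(2) = ½ log(1+√2)`, `⟨σ_0 σ_{(n,0)}⟩⁺_{β,0} → m_O(β)² = (1 − sinh(2β)^{-4})^{1/4}`
as `n → ∞` (Benettin–Gallavotti–Jona-Lasinio–Stella, CMP 30 (1973), §3: (3.1)
"`⟨σ_xσ_y⟩_a = ⟨σ_xσ_y⟩_p = ⟨σ_xσ_y⟩_+`", `β > β_c`, same row, by the sandwich (3.7) and duality
(3.10); (3.4) "`m_O²(β) = lim ⟨σ_xσ_y⟩_p`", the exact solution, Montroll–Potts–Ward 1963). The
assembly `twoPointPlus_row_tendsto_onsagerYang_sq_of_toeplitzDet_wu` with its two exact-solution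
inputs discharged: the Toeplitz form of the row correlations (`torusRowPair_tendsto_toeplitzDet_holds`)
and Wu's subcritical decay (`toeplitzDet_onsagerSymbol_exp_decay_holds`); the strong Szegő limit
theorem enters as the theorem `strongSzego_geometric`. [cite: BenettinGallavottiJonaLasinioStella1973, §3, eq. (3.1) with eq. (3.4)] -/
theorem twoPointPlus_row_tendsto_onsagerYang_sq_holds : twoPointPlus_row_tendsto_onsagerYang_sq :=
  twoPointPlus_row_tendsto_onsagerYang_sq_of_toeplitzDet_wu torusRowPair_tendsto_toeplitzDet_holds
    toeplitzDet_onsagerSymbol_exp_decay_holds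

end Literature.Probability.LatticeModels
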